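import Summits.PneNP.PneNP.Theorems.KarlinRubinMonotoneSufficesRoomStars

/-!
# Crux `MonotoneSuffices` (stmt-PneNP-18026), the GREEDY general detector — definitions

The randomized greedy clique-sampling detector for planted `⌈n^{1/2-δ}⌉`-cliques in `G(n,1/2)`
(fan-in-2 circuits of size `n^{(δ+ε) log₂ n}`; the best general exponent known, versus `δ+2δ²` for the
monotone covering-design detector `karlinRubin_exists_monotone_detector_cover`). One TRIAL is driven by a
hard-wired table of candidate vertices `c : Fin t → Fin M → Fin n`: level `i` scans `c i 0, c i 1, …` and
picks the FIRST candidate lying in the current pool (the common neighbours of the picks so far), for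
`t` levels; the trial accepts iff all `t` levels succeed and the picked `t`-clique has at least `θ` common
neighbours among the non-candidate vertices. The detector is an OR of `R` trials.

* `AdjAll x T u` (reducible) — `u` is adjacent in `x` to every vertex of `T` other than itself (the star predicate of
  the room theorem, `Room.card_star`);
* `pool x T` — the vertices outside `T` adjacent to all of `T`;
* `firstHit c P` — the first entry of the candidate list `c : Fin M → Fin n` lying in `P`, if any;
* `run x c i` — the set of picks after `i` levels (`none` once a level finds no candidate in the pool);
* `candSet c` — all candidates of a trial; `trialOut x c θ` — the trial's verdict; `detOut x cs θ` — the
  OR over the trials `cs : Fin R → _`.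

Definitions and their unfolding lemmas only; the analysis (`KarlinRubinMonotoneSufficesGreedy*.lean`) and
the circuits are separate files. All `--supports stmt-PneNP-18026`.
-/

set_option linter.dupNamespace false -- `Summit.PneNP.PneNP.…`: summit = sub-problem name (D-0017 single-conjunct layout)

namespace Summit.PneNP.PneNP.Theorems.MonotoneSuffices.Greedy

open Finset
open Literature.Probability.RandomGraphs.PlantedClique

variable {n : ℕ}

/-! ### Pools -/

/-- `u` is adjacent (in the edge vector `x`) to every vertex of `T` other than itself: every edge of the star
from `u` to `T` is present. [folklore] -/
abbrev AdjAll (x : EdgeVec n) (T : Finset (Fin n)) (u : Fin n) : Prop :=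
  ∀ e ∈ (univ.filter fun e : (⊤ : SimpleGraph (Fin n)).edgeSet => ∃ w ∈ T, (e : Sym2 (Fin n)) = s(u, w)),
    x e = true

/-- The pool of `T`: the vertices outside `T` adjacent to all of `T` (the candidates for extending the
clique `T`). [folklore] -/
def pool (x : EdgeVec n) (T : Finset (Fin n)) : Finset (Fin n) := (univ \ T).filter (AdjAll x T)

/-- Membership in the pool. [folklore] -/
theorem mem_pool {x : EdgeVec n} {T : Finset (Fin n)} {u : Fin n} : u ∈ pool x T ↔ u ∉ T ∧ AdjAll x T u := by
  simp [pool]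

/-! ### One level: the first candidate in the pool -/

/-- The first entry of the candidate list `c` lying in `P` (as a vertex), if any. [folklore] -/
def firstHit {M : ℕ} (c : Fin M → Fin n) (P : Finset (Fin n)) : Option (Fin n) :=
  ((List.finRange M).find? fun m => c m ∈ P).map c

/-- `firstHit c P = some v` iff some index hits `P`, its candidate is `v`, and no earlier index hits `P`. [folklore] -/
theorem firstHit_eq_some_iff {M : ℕ} (c : Fin M → Fin n) (P : Finset (Fin n)) (v : Fin n) :
    firstHit c P = some v ↔ ∃ m : Fin M, c m ∈ P ∧ c m = v ∧ ∀ m' < m, c m' ∉ P := by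
  unfold firstHit
  constructor
  · intro h
    obtain ⟨m, hm, hcv⟩ := Option.map_eq_some_iff.1 h
    have h1 := List.find?_eq_some_iff_getElem.1 hm
    obtain ⟨hP, j, hj, hjm, hbefore⟩ := h1
    refine ⟨m, by simpa using hP, hcv, fun m' hm' => ?_⟩
    have hj' : (List.finRange M)[j] = m := hjm
    have hjv : j = m.1 := by
      have := congrArg Fin.val hj'
      simpa using this
    have hlt : m'.1 < j := by rw [hjv]; exact hm'
    have := hbefore m'.1 hlt
    simpa using this
  · rintro ⟨m, hP, hcv, hbefore⟩
    rw [Option.map_eq_some_iff]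
    refine ⟨m, ?_, hcv⟩
    rw [List.find?_eq_some_iff_getElem]
    refine ⟨by simpa using hP, m.1, by simp, by simp, fun j hj => ?_⟩
    have := hbefore ⟨j, lt_trans hj m.2⟩ hj
    simpa using this

/-- `firstHit c P = none` iff no candidate lies in `P`. [folklore] -/
theorem firstHit_eq_none_iff {M : ℕ} (c : Fin M → Fin n) (P : Finset (Fin n)) :
    firstHit c P = none ↔ ∀ m : Fin M, c m ∉ P := by
  unfold firstHit
  simp [List.find?_eq_none]

/-- The first hit lies in `P`. [folklore] -/
theorem firstHit_mem {M : ℕ} {c : Fin M → Fin n} {P : Finset (Fin n)} {v : Fin n} (h : firstHit c P = some v) :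
    v ∈ P := by
  obtain ⟨m, hP, hcv, -⟩ := (firstHit_eq_some_iff c P v).1 h
  exact hcv ▸ hP

/-! ### The run of one trial -/

/-- The picks of the trial with candidate table `c : Fin t → Fin M → Fin n` after `i` levels: start from
`∅`; at level `i < t` add the first candidate of row `i` lying in the pool of the current picks, and FAIL
(`none`, absorbing) if there is none; levels `≥ t` do nothing. [folklore] -/
def run {t M : ℕ} (x : EdgeVec n) (c : Fin t → Fin M → Fin n) : ℕ → Option (Finset (Fin n))
  | 0 => some ∅
  | i + 1 => if h : i < t then (run x c i).bind fun T => (firstHit (c ⟨i, h⟩) (pool x T)).map fun v => insert v T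
      else run x c i

/-- The run starts from no picks. [folklore] -/
theorem run_zero {t M : ℕ} (x : EdgeVec n) (c : Fin t → Fin M → Fin n) : run x c 0 = some ∅ := rfl

/-- One level of the run, below `t`. [folklore] -/
theorem run_succ_of_lt {t M : ℕ} (x : EdgeVec n) (c : Fin t → Fin M → Fin n) {i : ℕ} (h : i < t) :
    run x c (i + 1) = (run x c i).bind fun T => (firstHit (c ⟨i, h⟩) (pool x T)).map fun v => insert v T := by
  rw [run, dif_pos h]

/-- Levels `≥ t` do nothing. [folklore] -/
theorem run_succ_of_le {t M : ℕ} (x : EdgeVec n) (c : Fin t → Fin M → Fin n) {i : ℕ} (h : t ≤ i) :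
    run x c (i + 1) = run x c i := by
  rw [run, dif_neg (not_lt.2 h)]

/-- A successful level adds one NEW vertex (from the pool) to the picks. [folklore] -/
theorem run_succ_eq_some_iff {t M : ℕ} (x : EdgeVec n) (c : Fin t → Fin M → Fin n) {i : ℕ} (h : i < t)
    (T' : Finset (Fin n)) :
    run x c (i + 1) = some T' ↔ ∃ T v, run x c i = some T ∧ firstHit (c ⟨i, h⟩) (pool x T) = some v ∧ T' = insert v T := by
  rw [run_succ_of_lt x c h]
  cases hr : run x c i with
  | none => simp
  | some T =>
      simp only [Option.bind_some, Option.map_eq_some_iff]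
      constructor
      · rintro ⟨v, hv, rfl⟩; exact ⟨T, v, rfl, hv, rfl⟩
      · rintro ⟨T₀, v, hT₀, hv, rfl⟩
        cases hT₀
        exact ⟨v, hv, rfl⟩

/-- After `i ≤ t` successful levels the picks form an `i`-set. [folklore] -/
theorem card_of_run_eq_some {t M : ℕ} (x : EdgeVec n) (c : Fin t → Fin M → Fin n) :
    ∀ {i : ℕ}, i ≤ t → ∀ {T : Finset (Fin n)}, run x c i = some T → #T = i
  | 0, _, T, h => by rw [run_zero] at h; cases h; rfl
  | i + 1, hi, T', h => by
      obtain ⟨T, v, hT, hv, rfl⟩ := (run_succ_eq_some_iff x c (by omega) T').1 h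
      have hvT : v ∉ T := (mem_pool.1 (firstHit_mem hv)).1
      rw [card_insert_of_notMem hvT, card_of_run_eq_some x c (by omega) hT]

/-! ### Candidates, the trial verdict, the detector -/

/-- All candidate vertices of a trial. [folklore] -/
def candSet {t M : ℕ} (c : Fin t → Fin M → Fin n) : Finset (Fin n) := univ.image fun p : Fin t × Fin M => c p.1 p.2

/-- Membership in the candidate set. [folklore] -/
theorem mem_candSet {t M : ℕ} {c : Fin t → Fin M → Fin n} {v : Fin n} : v ∈ candSet c ↔ ∃ i m, c i m = v := by
  simp [candSet]

/-- A trial has at most `t M` candidates. [folklore] -/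
theorem card_candSet_le {t M : ℕ} (c : Fin t → Fin M → Fin n) : #(candSet c) ≤ t * M := by
  refine (card_image_le).trans ?_
  simp

/-- The picks are candidates. [folklore] -/
theorem run_subset_candSet {t M : ℕ} (x : EdgeVec n) (c : Fin t → Fin M → Fin n) :
    ∀ (i : ℕ) {T : Finset (Fin n)}, run x c i = some T → T ⊆ candSet c
  | 0, T, h => by rw [run_zero] at h; cases h; exact empty_subset _
  | i + 1, T', h => by
      by_cases hi : i < t
      · obtain ⟨T, v, hT, hv, rfl⟩ := (run_succ_eq_some_iff x c hi T').1 h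
        obtain ⟨m, -, hcv, -⟩ := (firstHit_eq_some_iff _ _ v).1 hv
        refine insert_subset (mem_candSet.2 ⟨⟨i, hi⟩, m, hcv⟩) (run_subset_candSet x c i hT)
      · rw [run_succ_of_le x c (not_lt.1 hi)] at h
        exact run_subset_candSet x c i h

/-- **The verdict of one trial**: all `t` levels succeed and the picked clique has at least `θ` common
neighbours among the NON-candidate vertices. [folklore] -/
def trialOut {t M : ℕ} (x : EdgeVec n) (c : Fin t → Fin M → Fin n) (θ : ℕ) : Bool :=
  match run x c t with
  | none => false
  | some T => decide (θ ≤ #((univ \ candSet c).filter (AdjAll x T)))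

/-- The trial accepts iff the run succeeds and the count passes the threshold. [folklore] -/
theorem trialOut_eq_true_iff {t M : ℕ} (x : EdgeVec n) (c : Fin t → Fin M → Fin n) (θ : ℕ) :
    trialOut x c θ = true ↔ ∃ T, run x c t = some T ∧ θ ≤ #((univ \ candSet c).filter (AdjAll x T)) := by
  unfold trialOut
  cases h : run x c t with
  | none => simp
  | some T => simp

/-- **The greedy detector**: the OR of the `R` trials with candidate tables `cs r`. [folklore] -/
def detOut {R t M : ℕ} (x : EdgeVec n) (cs : Fin R → Fin t → Fin M → Fin n) (θ : ℕ) : Bool :=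
  decide (∃ r, trialOut x (cs r) θ = true)

/-- The detector accepts iff some trial accepts. [folklore] -/
theorem detOut_eq_true_iff {R t M : ℕ} (x : EdgeVec n) (cs : Fin R → Fin t → Fin M → Fin n) (θ : ℕ) :
    detOut x cs θ = true ↔ ∃ r, trialOut x (cs r) θ = true := by
  simp [detOut]

end Summit.PneNP.PneNP.Theorems.MonotoneSuffices.Greedy

namespace Summit.PneNP.PneNP.Theorems.MonotoneSuffices.Greedy

open Finset

/-- Registered sub-goal `greedy_defs` of stmt-PneNP-18026 (greedy detector, definitions file): a trial with a
`t × M` candidate table has at most `t M` candidate vertices (`card_candSet_le` unfolded). [folklore] -/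
theorem greedy_defs :
    ∀ (n t M : ℕ) (c : Fin t → Fin M → Fin n), #((Finset.univ : Finset (Fin t × Fin M)).image fun p => c p.1 p.2) ≤ t * M :=
  fun _ _ _ c => card_candSet_le c

end Summit.PneNP.PneNP.Theorems.MonotoneSuffices.Greedy
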